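import Mathlib
import HarnessLib

/-!
# A continuous function orthogonal to all monomials of a separating family vanishes

Helper for the crux `FemtoCurvatureTwoPoint` (stmt-QuantumFields-9363, route `LangevinControlUV`),
registered sub-goal `stub_axisPositive`: the Stone–Weierstrass half of the strict positivity of the
Wilson transfer matrix.

Let `X` be compact Hausdorff with a finite Borel measure `μ` charging every non-empty open set, let
`φᵢ : C(X, ℝ)` separate the points of `X`, and let `h : C(X, ℝ)` satisfy `∫ h · ∏ₜ φ_{word t} dμ = 0`
for every finite word (the empty word included). Then `h = 0` (`eq_zero_of_forall_integral_mul_word`):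
the functional `q ↦ ∫ h q dμ` is continuous for the uniform norm and kills the unital subalgebra
generated by the `φᵢ`, which is dense (Stone–Weierstrass), so `∫ h² dμ = 0`, and a non-negative
continuous function with zero integral against an open-positive measure is zero.
-/

set_option autoImplicit false

noncomputable section

open MeasureTheory Finset

namespace Summit.QuantumFields.YangMills.Theorems.FemtoCurvatureTwoPoint.SWVanish

variable {X : Type*} [TopologicalSpace X] [CompactSpace X] [T2Space X] [MeasurableSpace X]
  [BorelSpace X] (μ : Measure X) [IsFiniteMeasure μ]

omit [T2Space X] in
/-- A continuous real function on a compact space is integrable for a finite Borel measure.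
[folklore] -/
theorem integrable_continuousMap (f : C(X, ℝ)) : Integrable f μ :=
  Integrable.of_bound f.continuous.aestronglyMeasurable ‖f‖
    (ae_of_all _ fun x => f.norm_coe_le_norm x)

omit [T2Space X] in
/-- Products of continuous real functions are integrable (pointwise form). [folklore] -/
theorem integrable_mul (f g : C(X, ℝ)) : Integrable (fun x => f x * g x) μ := by
  simpa only [ContinuousMap.coe_mul, Pi.mul_def] using integrable_continuousMap μ (f * g)

omit [T2Space X] in
/-- The functional `q ↦ ∫ h q dμ` is continuous on `C(X, ℝ)` (uniform norm). [folklore] -/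
theorem continuous_integral_mul (h : C(X, ℝ)) :
    Continuous fun q : C(X, ℝ) => ∫ x, h x * q x ∂μ := by
  have hlin : IsLinearMap ℝ fun q : C(X, ℝ) => ∫ x, h x * q x ∂μ := by
    constructor
    · intro q q'
      have h1 := integrable_mul μ h q
      have h2 := integrable_mul μ h q'
      simp only [ContinuousMap.add_apply, mul_add]
      exact integral_add h1 h2
    · intro c q
      simp only [ContinuousMap.smul_apply, smul_eq_mul, mul_left_comm (h _) c, integral_const_mul]
  have key : ∀ q : C(X, ℝ), ‖hlin.mk' _ q‖ ≤ ‖h‖ * (μ Set.univ).toReal * ‖q‖ := by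
    intro q
    rw [IsLinearMap.mk'_apply]
    have hb : ∀ x, ‖h x * q x‖ ≤ ‖h‖ * ‖q‖ := fun x => by
      rw [norm_mul]
      exact mul_le_mul (h.norm_coe_le_norm x) (q.norm_coe_le_norm x) (norm_nonneg _) (norm_nonneg _)
    calc ‖∫ x, h x * q x ∂μ‖ ≤ ‖h‖ * ‖q‖ * (μ Set.univ).toReal :=
          norm_integral_le_of_norm_le_const (ae_of_all _ hb)
      _ = ‖h‖ * (μ Set.univ).toReal * ‖q‖ := by ring
  exact ((hlin.mk' _).mkContinuous _ key).continuous

/-- Elements of the submonoid generated by a family are word products of the family. [folklore] -/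
theorem exists_word_of_mem_closure {M : Type*} [CommMonoid M] {I : Type*} (φ : I → M) {m : M}
    (hm : m ∈ Submonoid.closure (Set.range φ)) :
    ∃ (n : ℕ) (word : Fin n → I), m = ∏ t, φ (word t) := by
  induction hm using Submonoid.closure_induction with
  | mem x hx =>
    obtain ⟨i, rfl⟩ := hx
    exact ⟨1, fun _ => i, by simp⟩
  | one => exact ⟨0, Fin.elim0, by simp⟩
  | mul x y _ _ hx hy =>
    obtain ⟨n, w₁, rfl⟩ := hx
    obtain ⟨m, w₂, rfl⟩ := hy
    refine ⟨n + m, Fin.append w₁ w₂, ?_⟩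
    rw [Fin.prod_univ_add]
    simp

variable [μ.IsOpenPosMeasure]

/-- **Orthogonality to all monomials of a separating family forces vanishing.** `X` compact
Hausdorff, `μ` a finite Borel measure positive on non-empty open sets, `φᵢ : C(X, ℝ)` separating
points, `h : C(X, ℝ)` with `∫ h ∏ₜ φ_{word t} dμ = 0` for all words: then `h = 0`
(Stone–Weierstrass + continuity of `q ↦ ∫ h q` + `∫ h² = 0`). [folklore] -/
theorem eq_zero_of_forall_integral_mul_word {I : Type*} (φ : I → C(X, ℝ))
    (hsep : ∀ x y : X, x ≠ y → ∃ i, φ i x ≠ φ i y) (h : C(X, ℝ))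
    (hzero : ∀ (n : ℕ) (word : Fin n → I), ∫ x, h x * ∏ t, φ (word t) x ∂μ = 0) : h = 0 := by
  classical
  -- the unital subalgebra generated by the family is dense
  set A : Subalgebra ℝ C(X, ℝ) := Algebra.adjoin ℝ (Set.range φ) with hA_def
  have hAsep : A.SeparatesPoints := by
    intro x y hxy
    obtain ⟨i, hi⟩ := hsep x y hxy
    exact ⟨φ i, ⟨φ i, Algebra.subset_adjoin ⟨i, rfl⟩, rfl⟩, hi⟩
  have hdense : A.topologicalClosure = ⊤ :=
    ContinuousMap.subalgebra_topologicalClosure_eq_top_of_separatesPoints A hAsep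
  -- the zero set of the functional
  set S : Set C(X, ℝ) := {q | ∫ x, h x * q x ∂μ = 0} with hS_def
  have hSclosed : IsClosed S := isClosed_eq (continuous_integral_mul μ h) continuous_const
  -- `A ⊆ S`
  have hAS : (A : Set C(X, ℝ)) ⊆ S := by
    intro q hq
    have hq' : q ∈ Subalgebra.toSubmodule A := hq
    rw [hA_def, Algebra.adjoin_eq_span] at hq'
    refine Submodule.span_induction (p := fun q _ => q ∈ S) ?_ ?_ ?_ ?_ hq'
    · intro m hm
      obtain ⟨n, word, rfl⟩ := exists_word_of_mem_closure φ hm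
      show ∫ x, h x * (∏ t, φ (word t)) x ∂μ = 0
      simp only [ContinuousMap.coe_prod, Finset.prod_apply]
      exact hzero n word
    · show ∫ x, h x * (0 : C(X, ℝ)) x ∂μ = 0
      simp
    · intro q q' _ _ hq hq'
      show ∫ x, h x * (q + q') x ∂μ = 0
      have h1 := integrable_mul μ h q
      have h2 := integrable_mul μ h q'
      have e1 : ∫ x, h x * q x ∂μ = 0 := hq
      have e2 : ∫ x, h x * q' x ∂μ = 0 := hq'
      simp only [ContinuousMap.add_apply, mul_add]
      rw [integral_add h1 h2, e1, e2, add_zero]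
    · intro c q _ hq
      show ∫ x, h x * (c • q) x ∂μ = 0
      have e1 : ∫ x, h x * q x ∂μ = 0 := hq
      simp only [ContinuousMap.smul_apply, smul_eq_mul, mul_left_comm (h _) c, integral_const_mul, e1,
        mul_zero]
  -- hence `S = everything`, in particular `h ∈ S`
  have hhS : h ∈ S := by
    have hcl : closure (A : Set C(X, ℝ)) ⊆ S := closure_minimal hAS hSclosed
    apply hcl
    rw [← Subalgebra.topologicalClosure_coe, hdense]
    trivial
  -- `∫ h² = 0` forces `h = 0`
  have hint : ∫ x, h x * h x ∂μ = 0 := hhS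
  have hsq_int : Integrable (fun x => h x * h x) μ := integrable_mul μ h h
  have hae : (fun x => h x * h x) =ᵐ[μ] 0 :=
    (integral_eq_zero_iff_of_nonneg (fun x => mul_self_nonneg (h x)) hsq_int).1 hint
  have hfun : (fun x => h x * h x) = 0 :=
    (Continuous.ae_eq_iff_eq μ (h.continuous.mul h.continuous) continuous_const).1 hae
  ext x
  have := congr_fun hfun x
  simpa using this

/-- **Registered sub-goal `stub_swVanish`** (`--supports stmt-QuantumFields-9363`): closed form of `eq_zero_of_forall_integral_mul_word` — a continuous function orthogonal to all monomials of a separating family vanishes. [folklore] -/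
theorem stub_swVanish : ∀ (X : Type) [TopologicalSpace X] [CompactSpace X] [T2Space X] [MeasurableSpace X] [BorelSpace X] (μ : MeasureTheory.Measure X) [MeasureTheory.IsFiniteMeasure μ] [μ.IsOpenPosMeasure] (I : Type) (φ : I → C(X, ℝ)), (∀ x y : X, x ≠ y → ∃ i, φ i x ≠ φ i y) → ∀ (h : C(X, ℝ)), (∀ (n : ℕ) (word : Fin n → I), (∫ x, h x * ∏ t, φ (word t) x ∂μ) = 0) → h = 0 := by
  intro X _ _ _ _ _ μ _ _ I φ hsep h hzero
  exact eq_zero_of_forall_integral_mul_word μ φ hsep h hzero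

end Summit.QuantumFields.YangMills.Theorems.FemtoCurvatureTwoPoint.SWVanish

end
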